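import Summits.AtomisticToContinuum.FouriersLaw.Theses.PhononMeanFreePath
import Literature.MathematicalPhysics.KineticTheory.HarmonicChainNESS
import Literature.MathematicalPhysics.KineticTheory.HarmonicChainFlux
import Literature.MathematicalPhysics.KineticTheory.LangevinChainLaSalle

/-!
# HarmonicCoherentPersistence (2/3): the damped harmonic impulse response and the Rieder–Lebowitz–Lieb conductance

Support for item `stmt-AtomisticToContinuum-11814` (`PhononMeanFreePath.HarmonicCoherentPersistence`).

For the pinned HARMONIC chain `P = pinnedChain ω₂ 0 0 γ` (`ω₂, γ > 0`) with `n` sites, the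
deterministic (zero-noise) constructed flow `Φ_t(x) = P.chainFlow n x 0 t` is the damped linear
system `ẇ = A w` in flat coordinates `w = x♭` (`A = driftMatrix ω₂ γ n`). We PROVE the time-domain
representation of the Lyapunov solution without any matrix exponential or spectral theory:

* `flat_harmonic_drift` — `Y(x)♭ = A x♭`; `hasDerivAt_flat_freeFlow` — `ẇ = A w` on `t > 0`;
* `lyapunovOp_corrIntegral` — the finite-time Lyapunov identity
  `A X_R + X_R Aᵀ = w(R)w(R)ᵀ - w(0)w(0)ᵀ` for `X_R = ∫₀ᴿ w wᵀ dt` (product rule + FTC);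
* `tendsto_corrIntegral` — `X_R → lyapSol A (x♭ x♭ᵀ)` as `R → ∞`: LaSalle (`Φ_R(x) → 0`, the
  tree's `pinnedChain_tendsto_freeFlow_zero`) and continuity of the inverse Lyapunov operator
  (a linear bijection in finite dimension, `isHurwitz_driftMatrix`);
* `chainCov_one_zero_eq` — `chainCov ω₂ γ n 1 0 = 2γ · lyapSol A (e_{p₀} e_{p₀}ᵀ)`, and the local
  energy balance at the last site `chainCov(1,0)_{p_N p_N} = fluxCoeff ω₂ γ (N+1)/γ`
  (`chainCov_one_zero_last_last`, the `(p_N,p_N)` entry of the Lyapunov equation: the mean power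
  `γ⟨p_N²⟩` absorbed by the cold right bath equals the mean bond current `⟨q_{N-1} p_N⟩`);
* hence for the impulse response `G_N(t) = (Φ_t(e_{p₀}))_{p_N}` of the `(N+1)`-site chain:
  `∫₀ᴿ G_N² → fluxCoeff ω₂ γ (N+1) / (2γ²)` (`tendsto_intervalIntegral_response_sq`), `G_N²` is
  integrable on `(0,∞)` for every `N` (`integrableOn_response_sq`) and
  `∫₀^∞ G_N² = fluxCoeff ω₂ γ (N+1)/(2γ²)` for `N ≥ 1` (`integral_response_sq`) — `2γ²∫₀^∞ G_N²` IS
  the Rieder–Lebowitz–Lieb / Nakazawa conductance `c_{N+1} → c_∞ > 0` (`tendsto_fluxCoeff`).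

References: Rieder–Lebowitz–Lieb 1967; Dhar 2008 §3.1 (`â·B̂ + B̂·âᵀ = D̂`); Roy–Dhar 2008 (2.8).
-/

noncomputable section

open MeasureTheory Filter Topology Set Matrix
open scoped NNReal
open Literature.MathematicalPhysics.KineticTheory.HeatConduction

namespace Summit.AtomisticToContinuum.FouriersLaw.Theorems.HarmonicCoherentPersistence

/-! ### The harmonic drift in flat coordinates -/

section Drift

variable (ω₂ γ : ℝ) (n : ℕ)

/-- **`Y(x)♭ = A x♭`**: the Langevin drift of the harmonic chain `pinnedChain ω₂ 0 0 γ` is the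
linear vector field of the drift matrix `A = [[0, 1], [-Φ, -Γ]]`. [cite: Dhar2008, §3.1] -/
theorem flat_harmonic_drift (x : PhaseSpace n) :
    flat ((pinnedChain ω₂ 0 0 γ).drift n x) = driftMatrix ω₂ γ n *ᵥ flat x := by
  have hγ1 : (pinnedChain ω₂ 0 0 γ).γ = γ := rfl
  have hflat : flat x = Sum.elim x.1 x.2 := rfl
  ext a
  rcases a with i | i
  · rw [hflat, driftMatrix, fromBlocks_mulVec]
    simp [flat, OscillatorChain.drift]
  · rw [hflat, driftMatrix, fromBlocks_mulVec]
    simp only [flat, OscillatorChain.drift, Sum.elim_inr, hγ1, pinnedChain_harmonic_partialQ_hamiltonian,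
      neg_mulVec, Pi.add_apply, Pi.neg_apply, frictionMatrix, mulVec_diagonal, Sum.elim_comp_inl,
      Sum.elim_comp_inr, OscillatorChain.bathWeight, bathMult]
    ring

end Drift

/-! ### The free (zero-noise) harmonic flow solves `ẇ = A w` -/

section Flow

variable {ω₂ γ : ℝ} (hω : 0 < ω₂) (hγ : 0 < γ) (n : ℕ)
include hω hγ

/-- The flat integral equation: `w(t)_a = x♭_a + ∫₀ᵗ (A w(s))_a ds` for `t ≥ 0`, where
`w(s) = (Φ_s x)♭` is the free harmonic flow in flat coordinates. [folklore] -/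
theorem flat_freeFlow_eq_integral (x : PhaseSpace n) (a : Fin n ⊕ Fin n) {t : ℝ} (ht : 0 ≤ t) :
    flat ((pinnedChain ω₂ 0 0 γ).chainFlow n x 0 t) a =
      flat x a + ∫ s in (0 : ℝ)..t,
        (driftMatrix ω₂ γ n *ᵥ flat ((pinnedChain ω₂ 0 0 γ).chainFlow n x 0 s)) a := by
  rcases a with i | i
  · rw [flat_inl, flat_inl, pinnedChain_freeFlow_fst_eq hω le_rfl le_rfl hγ.le n x i ht]
    congr 1
    refine intervalIntegral.integral_congr fun s _ => ?_
    rw [← flat_harmonic_drift ω₂ γ n]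
    rfl
  · rw [flat_inr, flat_inr, pinnedChain_freeFlow_snd_eq hω le_rfl le_rfl hγ.le n x i ht]
    congr 1
    refine intervalIntegral.integral_congr fun s _ => ?_
    rw [← flat_harmonic_drift ω₂ γ n, pinnedChain_drift_apply]
    rfl

/-- The free flow in flat coordinates is continuous in time. [folklore] -/
theorem continuous_flat_freeFlow (x : PhaseSpace n) (a : Fin n ⊕ Fin n) :
    Continuous fun s => flat ((pinnedChain ω₂ 0 0 γ).chainFlow n x 0 s) a :=
  (continuous_flat_apply a).comp
    (pinnedChain_continuous_chainFlow hω le_rfl le_rfl hγ.le n x (η := 0) continuous_zero)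

/-- `s ↦ (A w(s))_a` is continuous. [folklore] -/
theorem continuous_mulVec_flat_freeFlow (x : PhaseSpace n) (a : Fin n ⊕ Fin n) :
    Continuous fun s => (driftMatrix ω₂ γ n *ᵥ flat ((pinnedChain ω₂ 0 0 γ).chainFlow n x 0 s)) a :=
  (continuous_mulVec_flat_apply _ a).comp
    (pinnedChain_continuous_chainFlow hω le_rfl le_rfl hγ.le n x (η := 0) continuous_zero)

/-- **`ẇ = A w`**: for `t > 0` each flat coordinate of the free harmonic flow is differentiable
with derivative `(A w(t))_a`. [folklore] -/
theorem hasDerivAt_flat_freeFlow (x : PhaseSpace n) (a : Fin n ⊕ Fin n) {t : ℝ} (ht : 0 < t) :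
    HasDerivAt (fun s => flat ((pinnedChain ω₂ 0 0 γ).chainFlow n x 0 s) a)
      ((driftMatrix ω₂ γ n *ᵥ flat ((pinnedChain ω₂ 0 0 γ).chainFlow n x 0 t)) a) t := by
  have hg := continuous_mulVec_flat_freeFlow hω hγ n x a
  have hI : HasDerivAt (fun s => ∫ u in (0 : ℝ)..s,
      (driftMatrix ω₂ γ n *ᵥ flat ((pinnedChain ω₂ 0 0 γ).chainFlow n x 0 u)) a)
      ((driftMatrix ω₂ γ n *ᵥ flat ((pinnedChain ω₂ 0 0 γ).chainFlow n x 0 t)) a) t :=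
    intervalIntegral.integral_hasDerivAt_right (hg.intervalIntegrable 0 t)
      (hg.stronglyMeasurableAtFilter _ _) hg.continuousAt
  refine (hI.const_add (flat x a)).congr_of_eventuallyEq ?_
  filter_upwards [Ioi_mem_nhds ht] with s hs
  exact flat_freeFlow_eq_integral hω hγ n x a (le_of_lt hs)

/-! ### The finite-time Lyapunov identity and its limit -/

/-- **Finite-time Lyapunov identity** (product rule + FTC): with `X_R = ∫₀ᴿ w(s) w(s)ᵀ ds`,
`A X_R + X_R Aᵀ = w(R) w(R)ᵀ - x♭ x♭ᵀ` for `R ≥ 0`. [folklore] -/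
theorem lyapunovOp_corrIntegral (x : PhaseSpace n) {R : ℝ} (hR : 0 ≤ R) :
    lyapunovOp (driftMatrix ω₂ γ n) (Matrix.of fun a b => ∫ s in (0 : ℝ)..R,
        flat ((pinnedChain ω₂ 0 0 γ).chainFlow n x 0 s) a * flat ((pinnedChain ω₂ 0 0 γ).chainFlow n x 0 s) b) =
      vecMulVec (flat ((pinnedChain ω₂ 0 0 γ).chainFlow n x 0 R)) (flat ((pinnedChain ω₂ 0 0 γ).chainFlow n x 0 R)) -
        vecMulVec (flat x) (flat x) := by
  set A := driftMatrix ω₂ γ n with hA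
  set w : ℝ → Fin n ⊕ Fin n → ℝ := fun s => flat ((pinnedChain ω₂ 0 0 γ).chainFlow n x 0 s) with hw
  have hwc : ∀ a, Continuous fun s => w s a := fun a => continuous_flat_freeFlow hω hγ n x a
  have hAwc : ∀ a, Continuous fun s => (A *ᵥ w s) a := fun a => continuous_mulVec_flat_freeFlow hω hγ n x a
  have hw0 : w 0 = flat x := by
    simp only [hw, pinnedChain_freeFlow_zero]
  ext a b
  -- FTC for `s ↦ w_a(s) w_b(s)`
  have hderiv : ∀ s ∈ Ioo 0 R, HasDerivAt (fun s => w s a * w s b)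
      ((A *ᵥ w s) a * w s b + w s a * (A *ᵥ w s) b) s := fun s hs =>
    (hasDerivAt_flat_freeFlow hω hγ n x a hs.1).mul (hasDerivAt_flat_freeFlow hω hγ n x b hs.1)
  have hcont : ContinuousOn (fun s => w s a * w s b) (Icc 0 R) := ((hwc a).mul (hwc b)).continuousOn
  have hint : IntervalIntegrable (fun s => (A *ᵥ w s) a * w s b + w s a * (A *ᵥ w s) b) volume 0 R :=
    (((hAwc a).mul (hwc b)).add ((hwc a).mul (hAwc b))).intervalIntegrable 0 R
  have hFTC := intervalIntegral.integral_eq_sub_of_hasDerivAt_of_le hR hcont hderiv hint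
  -- expand both sides
  have hsumA : ∀ s, (A *ᵥ w s) a * w s b = ∑ k, A a k * (w s k * w s b) := fun s => by
    simp only [mulVec, dotProduct, Finset.sum_mul]
    exact Finset.sum_congr rfl fun k _ => by ring
  have hsumB : ∀ s, w s a * (A *ᵥ w s) b = ∑ k, (w s a * w s k) * A b k := fun s => by
    simp only [mulVec, dotProduct, Finset.mul_sum]
    exact Finset.sum_congr rfl fun k _ => by ring
  have hIk : ∀ k l, IntervalIntegrable (fun s => w s k * w s l) volume 0 R := fun k l =>
    ((hwc k).mul (hwc l)).intervalIntegrable 0 R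
  have hI1 : IntervalIntegrable (fun s => (A *ᵥ w s) a * w s b) volume 0 R :=
    ((hAwc a).mul (hwc b)).intervalIntegrable 0 R
  have hI2 : IntervalIntegrable (fun s => w s a * (A *ᵥ w s) b) volume 0 R :=
    ((hwc a).mul (hAwc b)).intervalIntegrable 0 R
  have e1 : (∫ s in (0 : ℝ)..R, (A *ᵥ w s) a * w s b) = ∑ k, A a k * ∫ s in (0 : ℝ)..R, w s k * w s b := by
    simp_rw [hsumA]
    rw [intervalIntegral.integral_finsetSum fun k _ => (hIk k b).const_mul (A a k)]
    exact Finset.sum_congr rfl fun k _ => intervalIntegral.integral_const_mul _ _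
  have e2 : (∫ s in (0 : ℝ)..R, w s a * (A *ᵥ w s) b) = ∑ k, (∫ s in (0 : ℝ)..R, w s a * w s k) * A b k := by
    simp_rw [hsumB]
    rw [intervalIntegral.integral_finsetSum fun k _ => (hIk a k).mul_const (A b k)]
    exact Finset.sum_congr rfl fun k _ => intervalIntegral.integral_mul_const _ _
  have key : (∑ k, A a k * ∫ s in (0 : ℝ)..R, w s k * w s b) +
      ∑ k, (∫ s in (0 : ℝ)..R, w s a * w s k) * A b k = w R a * w R b - flat x a * flat x b := by
    rw [← hw0, ← hFTC, intervalIntegral.integral_add hI1 hI2, e1, e2]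
  simpa only [lyapunovOp_apply, Matrix.add_apply, Matrix.mul_apply, Matrix.sub_apply, vecMulVec_apply,
    transpose_apply, Matrix.of_apply] using key

variable {n}

/-- **`X_R → lyapSol A (x♭ x♭ᵀ)` as `R → ∞`** (`n ≥ 1`): by LaSalle the free flow relaxes to `0`,
so the right-hand side of the finite-time Lyapunov identity tends to `-x♭ x♭ᵀ`, and the Lyapunov
operator of the Hurwitz matrix `A` is a linear homeomorphism of the matrix space. [folklore] -/
theorem tendsto_corrIntegral (hn : 0 < n) (x : PhaseSpace n) :
    Tendsto (fun R : ℝ => Matrix.of fun a b => ∫ s in (0 : ℝ)..R,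
        flat ((pinnedChain ω₂ 0 0 γ).chainFlow n x 0 s) a * flat ((pinnedChain ω₂ 0 0 γ).chainFlow n x 0 s) b)
      atTop (𝓝 (lyapSol (driftMatrix ω₂ γ n) (vecMulVec (flat x) (flat x)))) := by
  set A := driftMatrix ω₂ γ n with hA
  set w : ℝ → Fin n ⊕ Fin n → ℝ := fun s => flat ((pinnedChain ω₂ 0 0 γ).chainFlow n x 0 s) with hw
  set X : ℝ → Matrix (Fin n ⊕ Fin n) (Fin n ⊕ Fin n) ℝ := fun R => Matrix.of fun a b =>
    ∫ s in (0 : ℝ)..R, w s a * w s b with hX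
  have hHur : IsHurwitz A := isHurwitz_driftMatrix hω hγ n
  -- the flow relaxes: `w(R) → 0`
  have hflow := pinnedChain_tendsto_freeFlow_zero hω le_rfl le_rfl hγ hn x
  have hw : ∀ a, Tendsto (fun R => w R a) atTop (𝓝 0) := fun a => by
    have h := ((continuous_flat_apply a).tendsto (0 : PhaseSpace n)).comp hflow
    have h0 : flat (0 : PhaseSpace n) a = 0 := by rcases a with i | i <;> rfl
    rw [h0] at h
    exact h
  have hE : Tendsto (fun R => vecMulVec (w R) (w R) - vecMulVec (flat x) (flat x)) atTop
      (𝓝 (-vecMulVec (flat x) (flat x))) := by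
    have h1 : Tendsto (fun R => vecMulVec (w R) (w R)) atTop (𝓝 0) := by
      refine tendsto_pi_nhds.mpr fun a => tendsto_pi_nhds.mpr fun b => ?_
      simpa [vecMulVec_apply] using (hw a).mul (hw b)
    simpa using h1.sub_const (vecMulVec (flat x) (flat x))
  -- the Lyapunov operator of `X R` is that right-hand side, eventually
  have hLX : ∀ᶠ R in atTop, lyapunovOp A (X R) = vecMulVec (w R) (w R) - vecMulVec (flat x) (flat x) := by
    filter_upwards [eventually_ge_atTop 0] with R hR
    exact lyapunovOp_corrIntegral hω hγ n x hR
  -- invert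
  have hbij := hHur.lyapunovOp_bijective
  set L := LinearEquiv.ofBijective (lyapunovOp A) hbij with hL
  have hLc : Continuous (L.symm : Matrix (Fin n ⊕ Fin n) (Fin n ⊕ Fin n) ℝ →ₗ[ℝ]
      Matrix (Fin n ⊕ Fin n) (Fin n ⊕ Fin n) ℝ) :=
    LinearMap.continuous_of_finiteDimensional _
  have hlim := (hLc.tendsto _).comp (hE.congr' (hLX.mono fun R hR => hR.symm))
  have hXeq : ∀ R, (L.symm : Matrix (Fin n ⊕ Fin n) (Fin n ⊕ Fin n) ℝ →ₗ[ℝ]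
      Matrix (Fin n ⊕ Fin n) (Fin n ⊕ Fin n) ℝ) (lyapunovOp A (X R)) = X R := fun R =>
    L.symm_apply_apply (X R)
  have hsol : (L.symm : Matrix (Fin n ⊕ Fin n) (Fin n ⊕ Fin n) ℝ →ₗ[ℝ]
      Matrix (Fin n ⊕ Fin n) (Fin n ⊕ Fin n) ℝ) (-vecMulVec (flat x) (flat x)) =
      lyapSol A (vecMulVec (flat x) (flat x)) := by
    rw [lyapSol, dif_pos hbij]
    rfl
  rw [← hsol]
  refine hlim.congr fun R => ?_
  simp only [Function.comp_apply, hXeq]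

/-- Entrywise form on the diagonal: `∫₀ᴿ w_a² → (lyapSol A (x♭ x♭ᵀ))_{aa}`. [folklore] -/
theorem tendsto_intervalIntegral_flat_sq (hn : 0 < n) (x : PhaseSpace n) (a : Fin n ⊕ Fin n) :
    Tendsto (fun R : ℝ => ∫ s in (0 : ℝ)..R, flat ((pinnedChain ω₂ 0 0 γ).chainFlow n x 0 s) a ^ 2)
      atTop (𝓝 (lyapSol (driftMatrix ω₂ γ n) (vecMulVec (flat x) (flat x)) a a)) := by
  have h := tendsto_pi_nhds.mp (tendsto_pi_nhds.mp (tendsto_corrIntegral hω hγ hn x) a) a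
  simp only [Matrix.of_apply] at h
  simpa only [pow_two] using h

end Flow

/-! ### The covariance at `(T_L, T_R) = (1, 0)` and the energy balance at the last site -/

section Covariance

variable {ω₂ γ : ℝ} (hω : 0 < ω₂) (hγ : 0 < γ)
include hω hγ

omit hω hγ in
/-- The noise matrix with only the left bath hot: `Σ(1, 0) = 2γ e_{p₀} e_{p₀}ᵀ`. [folklore] -/
theorem noiseMatrix_one_zero (N : ℕ) :
    noiseMatrix γ (N + 1) 1 0 =
      (2 * γ) • vecMulVec (Pi.single (Sum.inr (0 : Fin (N + 1))) (1 : ℝ)) (Pi.single (Sum.inr 0) 1) := by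
  ext a b
  rcases a with i | i <;> rcases b with j | j
  · simp [noiseMatrix, vecMulVec_apply]
  · simp [noiseMatrix, vecMulVec_apply]
  · simp [noiseMatrix, vecMulVec_apply]
  · simp only [noiseMatrix, fromBlocks_apply₂₂, diagonal_apply, bathTemp, Matrix.smul_apply,
      vecMulVec_apply, Pi.single_apply, Sum.inr.injEq, smul_eq_mul, mul_ite, mul_one, mul_zero]
    by_cases hij : i = j
    · subst hij
      by_cases hi : i = 0
      · subst hi; simp
      · have : i.val ≠ 0 := fun h => hi (Fin.ext h)
        simp [hi, this]
    · have : ¬ (i = 0 ∧ j = 0) := fun h => hij (h.1.trans h.2.symm)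
      simp only [if_neg hij]
      split_ifs <;> simp_all

/-- **`chainCov(1, 0) = 2γ · lyapSol A (e_{p₀} e_{p₀}ᵀ)`** (linearity of the Lyapunov solution).
[folklore] -/
theorem chainCov_one_zero_eq (N : ℕ) :
    chainCov ω₂ γ (N + 1) 1 0 =
      (2 * γ) • lyapSol (driftMatrix ω₂ γ (N + 1))
        (vecMulVec (flat ((0, Pi.single 0 1) : PhaseSpace (N + 1))) (flat ((0, Pi.single 0 1) : PhaseSpace (N + 1)))) := by
  have hflat : flat ((0, Pi.single 0 1) : PhaseSpace (N + 1)) = Pi.single (Sum.inr 0) 1 := by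
    rw [← coordVec_inr, flat_coordVec]
  rw [hflat, chainCov, noiseMatrix_one_zero, (isHurwitz_driftMatrix hω hγ (N + 1)).lyapSol_smul]

/-- **Energy balance at the last site**: for the `(N+1)`-site chain with `N ≥ 1` and bath
temperatures `(1, 0)`, `⟨p_N²⟩ = c_{N+1}/γ` — the `(p_N, p_N)` entry of the Lyapunov equation says
that the power `γ(⟨p_N²⟩ - T_R)` absorbed by the right bath equals the mean current `⟨q_{N-1}p_N⟩`
of the last bond, which is `fluxCoeff · (T_L - T_R)`. [cite: Dhar2008, §3.1] -/
theorem chainCov_one_zero_last_last {N : ℕ} (hN : 1 ≤ N) :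
    chainCov ω₂ γ (N + 1) 1 0 (Sum.inr (Fin.last N)) (Sum.inr (Fin.last N)) =
      fluxCoeff ω₂ γ (N + 1) / γ := by
  set l : Fin (N + 1) := Fin.last N with hl
  set C := chainCov ω₂ γ (N + 1) 1 0 with hC
  have hlv : l.val = N := rfl
  have hsym : ∀ k, C (Sum.inr l) (Sum.inl k) = C (Sum.inl k) (Sum.inr l) := fun k => by
    have := congrFun (congrFun (chainCov_transpose hω hγ (N + 1) 1 0) (Sum.inl k)) (Sum.inr l)
    rwa [transpose_apply] at this
  have h := congrFun (congrFun (chainCov_lyapunov hω hγ (N + 1) 1 0) (Sum.inr l)) (Sum.inr l)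
  rw [Matrix.add_apply, Matrix.add_apply, driftMatrix_mul_apply_inr,
    mul_driftMatrix_transpose_apply_inr, Matrix.zero_apply] at h
  have hbm : (bathMult (N + 1) l : ℝ) = 1 := by
    simp only [bathMult, hlv]
    rw [if_neg (by omega), if_pos (by omega), zero_add]
  have hbt : noiseMatrix γ (N + 1) 1 0 (Sum.inr l) (Sum.inr l) = 0 := by
    simp only [noiseMatrix, fromBlocks_apply₂₂, diagonal_apply_eq, bathTemp, hlv]
    rw [if_neg (by omega), if_pos (by omega)]
    ring
  rw [← hC] at h
  simp only [hbm, hbt, mul_one, add_zero, hsym] at h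
  -- `h : -(∑ Φ l k * Z k) - γ C_ll + (-(∑ Z k * Φ l k) - γ C_ll) = 0`
  have hΦZ : (forceMatrix ω₂ (N + 1) *ᵥ fun k => C (Sum.inl k) (Sum.inr l)) l = -(γ * C (Sum.inr l) (Sum.inr l)) := by
    have e : ∑ k, C (Sum.inl k) (Sum.inr l) * forceMatrix ω₂ (N + 1) l k =
        ∑ k, forceMatrix ω₂ (N + 1) l k * C (Sum.inl k) (Sum.inr l) :=
      Finset.sum_congr rfl fun k _ => mul_comm _ _
    rw [e] at h
    simp only [mulVec, dotProduct]
    linarith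
  rw [forceMatrix_mulVec_apply_eq, dif_pos (show 0 < l.val by omega),
    dif_neg (show ¬ (l.val + 1 < N + 1) by omega)] at hΦZ
  have hself : C (Sum.inl l) (Sum.inr l) = 0 := chainCov_inl_inr_self hω hγ 1 0 l
  simp only [hself, mul_zero, zero_sub, sub_zero, zero_add] at hΦZ
  -- `hΦZ : -Z (l-1) = -(γ C_ll)`; the last bond carries `fluxCoeff · (1 - 0)`
  have hbond := chainCov_bond_eq_fluxCoeff hω hγ (N := N + 1) 1 0 (N - 1) (by omega)
  have e1 : (⟨N - 1 + 1, by omega⟩ : Fin (N + 1)) = l := Fin.ext (by simp [hlv]; omega)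
  have e2 : (⟨N - 1, by omega⟩ : Fin (N + 1)) = ⟨l.val - 1, by omega⟩ := Fin.ext (by simp [hlv])
  rw [e1, e2, ← hC] at hbond
  rw [hbond] at hΦZ
  field_simp
  linarith

end Covariance

/-! ### The impulse response: square-integrability and the conductance identity -/

section Response

variable {ω₂ γ : ℝ} (hω : 0 < ω₂) (hγ : 0 < γ)
include hω hγ

/-- `∫₀ᴿ G_N² → fluxCoeff ω₂ γ (N+1) / (2γ²)` as `R → ∞` (`N ≥ 1`), for the impulse response
`G_N(t) = (Φ_t(e_{p₀}))_{p_N}` of the free damped harmonic `(N+1)`-site chain.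
[cite: Dhar2008, §3.1 and §3.2] -/
theorem tendsto_intervalIntegral_response_sq {N : ℕ} (hN : 1 ≤ N) :
    Tendsto (fun R : ℝ => ∫ s in (0 : ℝ)..R,
        ((pinnedChain ω₂ 0 0 γ).chainFlow (N + 1) ((0, Pi.single 0 1) : PhaseSpace (N + 1)) 0 s).2 (Fin.last N) ^ 2)
      atTop (𝓝 (fluxCoeff ω₂ γ (N + 1) / (2 * γ ^ 2))) := by
  have h := tendsto_intervalIntegral_flat_sq hω hγ (Nat.succ_pos N) ((0, Pi.single 0 1) : PhaseSpace (N + 1))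
    (Sum.inr (Fin.last N))
  simp only [flat_inr] at h
  have hval : lyapSol (driftMatrix ω₂ γ (N + 1))
      (vecMulVec (flat ((0, Pi.single 0 1) : PhaseSpace (N + 1))) (flat ((0, Pi.single 0 1) : PhaseSpace (N + 1))))
      (Sum.inr (Fin.last N)) (Sum.inr (Fin.last N)) = fluxCoeff ω₂ γ (N + 1) / (2 * γ ^ 2) := by
    have h2 := congrFun (congrFun (chainCov_one_zero_eq hω hγ N) (Sum.inr (Fin.last N))) (Sum.inr (Fin.last N))
    rw [chainCov_one_zero_last_last hω hγ hN, Matrix.smul_apply, smul_eq_mul] at h2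
    field_simp at h2
    field_simp
    linarith
  rw [hval] at h
  exact h

/-- **`G_N²` is integrable on `(0, ∞)`** for every `N` (the running integrals `∫₀ᴿ G_N²` converge).
[folklore] -/
theorem integrableOn_response_sq (N : ℕ) :
    IntegrableOn (fun s : ℝ =>
      ((pinnedChain ω₂ 0 0 γ).chainFlow (N + 1) ((0, Pi.single 0 1) : PhaseSpace (N + 1)) 0 s).2 (Fin.last N) ^ 2)
      (Ioi 0) := by
  have h := tendsto_intervalIntegral_flat_sq hω hγ (Nat.succ_pos N) ((0, Pi.single 0 1) : PhaseSpace (N + 1))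
    (Sum.inr (Fin.last N))
  simp only [flat_inr] at h
  have hc : Continuous fun s : ℝ =>
      ((pinnedChain ω₂ 0 0 γ).chainFlow (N + 1) ((0, Pi.single 0 1) : PhaseSpace (N + 1)) 0 s).2 (Fin.last N) ^ 2 := by
    have := continuous_flat_freeFlow hω hγ (N + 1) ((0, Pi.single 0 1) : PhaseSpace (N + 1)) (Sum.inr (Fin.last N))
    simp only [flat_inr] at this
    exact this.pow 2
  obtain ⟨I, hI⟩ : ∃ I : ℝ, Tendsto (fun R : ℝ => ∫ s in (0 : ℝ)..R,
      ((pinnedChain ω₂ 0 0 γ).chainFlow (N + 1) ((0, Pi.single 0 1) : PhaseSpace (N + 1)) 0 s).2 (Fin.last N) ^ 2)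
      atTop (𝓝 I) := ⟨_, h⟩
  refine integrableOn_Ioi_of_intervalIntegral_norm_tendsto I 0
    (fun R => (hc.integrableOn_Icc).mono_set Ioc_subset_Icc_self) tendsto_id ?_
  refine hI.congr fun R => intervalIntegral.integral_congr fun s _ => ?_
  simp only [Real.norm_eq_abs, abs_pow, sq_abs]

/-- **The coherent channel of the harmonic chain is the RLL conductance**:
`∫₀^∞ G_N² = fluxCoeff ω₂ γ (N+1) / (2γ²)` for `N ≥ 1`. [cite: Dhar2008, §3.1 and §3.2] -/
theorem integral_response_sq {N : ℕ} (hN : 1 ≤ N) :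
    ∫ s in Ioi (0 : ℝ),
      ((pinnedChain ω₂ 0 0 γ).chainFlow (N + 1) ((0, Pi.single 0 1) : PhaseSpace (N + 1)) 0 s).2 (Fin.last N) ^ 2 =
      fluxCoeff ω₂ γ (N + 1) / (2 * γ ^ 2) :=
  tendsto_nhds_unique
    (intervalIntegral_tendsto_integral_Ioi 0 (integrableOn_response_sq hω hγ N) tendsto_id)
    (tendsto_intervalIntegral_response_sq hω hγ hN)

end Response

end Summit.AtomisticToContinuum.FouriersLaw.Theorems.HarmonicCoherentPersistence
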